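import Summits.AtomisticToContinuum.HydrodynamicLimit.Theorems.CollisionIsometryCLTCollisionalTransferLocalityBlockFields
import HarnessLib

/-!
# Orbit regularity of the block kinetic fluxes
(registered stub `stub_blockFluxRegularity` of the line `birth` for the crux `FastMomentRelaxation`,
stmt-AtomisticToContinuum-9522, route `StiffCollisionalRelaxation`)

The crux says that the block traceless kinetic stress `D` and the block kinetic heat flux `q` of
`N + 1` deterministic hard spheres (flow `(Φ N).flow s z`, local Gibbs initial law
`localGibbsLaw σ a₀ u₀ θ₀ N (Φ N)`) vanish in `L²([0,t] × 𝕋³)` in probability. The skeleton splits the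
event `{δ < ∫_{[0,t]} ∫ₓ (ΣΣ D² + |q|²)}` into a `D`-channel and a `q`-channel; splitting the iterated
Bochner integral additively needs, for almost every initial datum, integrability in `x` of each
channel density at every `s ∈ [0, t]` and integrability in `s` of the space integrals on `[0, t]`.
This file proves exactly that (the honest form of the Bochner junk-value seam):

* the bad set of the flow is null for the local Gibbs law (`localGibbsLaw_compl_good'`), so it is
  enough to treat GOOD initial data;
* for any configuration with speeds `≤ V` and a continuous kernel `0 ≤ φ N ≤ Φ_b` (the kernel slice is
  bounded on the compact torus) both channel densities are bounded by
  `9 (8 Φ_b V²)² + (4 Φ_b V³)²` (`kineticIntegrand_le`) and measurable in `x` (finite sums of products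
  of continuous functions and the measurable junk-guarded block velocity, `measurable_uB`), hence
  integrable on the probability space `𝕋³`;
* along a good orbit speeds are `≤ √(2 E(z))` for all times (energy conservation,
  `norm_vel_orbit_le`) and the orbit is measurable in time (`measurable_orbit`), so each space
  integral is measurable in `s` (Fubini measurability, `StronglyMeasurable.integral_prod_right'`) and
  bounded, hence integrable on the finite-measure interval `[0, t]`.

Folklore measure theory; no source is cited (Spohn 1991 Part I §3 is the background for the block
fields, on the imported toolkit `…CollisionalTransferLocalityBlockFields`).
-/

noncomputable section

open MeasureTheory Set Filter Topology
open scoped ENNReal BigOperators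
open Literature.MathematicalPhysics.KineticTheory (T3 V3 localGibbsLaw)
open Summit.AtomisticToContinuum.HydrodynamicLimit.Theorems.HemisphereAffineSlaving
  (Cfg Flows AdmissibleKernel rhoB mB uB Dst qfl)

namespace Summit.AtomisticToContinuum.HydrodynamicLimit.Theorems.FastMomentRelaxationBirth

open Summit.AtomisticToContinuum.HydrodynamicLimit.Theorems.HemisphereAffineSlaving
open Literature.Analysis.FluidPDE (configEnergy)

namespace BlockFluxRegularity

variable {N : ℕ} {φ : ℕ → T3 → ℝ}

/-! ### Measurability of the two channel densities in `(z, x)` -/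

/-- `(z, x) ↦ Σ_jk D_jk(z, x)²` is measurable on phase space × torus for a continuous kernel
(finite sums of products of continuous functions and the measurable junk-guarded `ū`). [folklore] -/
theorem measurable_DstSq (hφc : Continuous (φ N)) :
    Measurable fun p : Cfg N × T3 => ∑ j, ∑ k, Dst φ N p.1 p.2 j k ^ 2 := by
  -- adapted from the proof of `measurable_kineticIntegrand` (file …BlockFields)
  haveI : ∀ i : Fin (N + 1), BorelSpace (T3 × V3) := fun _ => Prod.borelSpace
  have hU := measurable_uB (N := N) hφc
  have hD : ∀ j k, Measurable fun p : Cfg N × T3 => Dst φ N p.1 p.2 j k := by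
    intro j k
    simp only [Dst_eq]
    generalize uB φ N = u at hU ⊢
    by_cases hjk : j = k
    · simp only [hjk, if_true]
      fun_prop
    · simp only [hjk, if_false, sub_zero]
      fun_prop
  exact Finset.measurable_sum _ fun j _ => Finset.measurable_sum _ fun k _ => (hD j k).pow_const 2

/-- `(z, x) ↦ |q(z, x)|²` is measurable on phase space × torus for a continuous kernel. [folklore] -/
theorem measurable_qflSq (hφc : Continuous (φ N)) :
    Measurable fun p : Cfg N × T3 => ‖qfl φ N p.1 p.2‖ ^ 2 := by
  -- adapted from the proof of `measurable_kineticIntegrand` (file …BlockFields)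
  haveI : ∀ i : Fin (N + 1), BorelSpace (T3 × V3) := fun _ => Prod.borelSpace
  have hU := measurable_uB (N := N) hφc
  have hq : Measurable fun p : Cfg N × T3 => qfl φ N p.1 p.2 := by
    simp only [qfl_eq]
    generalize uB φ N = u at hU ⊢
    fun_prop
  exact hq.norm.pow_const 2

/-! ### Pointwise bounds and integrability in `x` at bounded speeds -/

section Bounds

variable {w : Cfg N} {x : T3} {Φb Vb : ℝ}

/-- `Σ_jk D_jk² ≤ 9 (8 Φ_b V²)² + (4 Φ_b V³)²` when `0 ≤ φ ≤ Φ_b` and all speeds are `≤ V`. [folklore] -/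
theorem DstSq_le (hφ0 : ∀ y, 0 ≤ φ N y) (hφb : ∀ y, φ N y ≤ Φb) (hVb : 0 ≤ Vb)
    (hV : ∀ i, ‖(w i).2‖ ≤ Vb) :
    ∑ j, ∑ k, Dst φ N w x j k ^ 2 ≤ 9 * (8 * Φb * Vb ^ 2) ^ 2 + (4 * Φb * Vb ^ 3) ^ 2 :=
  le_trans (le_add_of_nonneg_right (by positivity)) (kineticIntegrand_le (x := x) hφ0 hφb hVb hV)

/-- `|q|² ≤ 9 (8 Φ_b V²)² + (4 Φ_b V³)²` when `0 ≤ φ ≤ Φ_b` and all speeds are `≤ V`. [folklore] -/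
theorem qflSq_le (hφ0 : ∀ y, 0 ≤ φ N y) (hφb : ∀ y, φ N y ≤ Φb) (hVb : 0 ≤ Vb)
    (hV : ∀ i, ‖(w i).2‖ ≤ Vb) :
    ‖qfl φ N w x‖ ^ 2 ≤ 9 * (8 * Φb * Vb ^ 2) ^ 2 + (4 * Φb * Vb ^ 3) ^ 2 :=
  le_trans (le_add_of_nonneg_left (by positivity)) (kineticIntegrand_le (x := x) hφ0 hφb hVb hV)

/-- The `D`-channel density `x ↦ Σ_jk D_jk(w, x)²` is integrable on `𝕋³` for a continuous kernel
`0 ≤ φ ≤ Φ_b` and a configuration with speeds `≤ V` (bounded and measurable on a probability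
space). [folklore] -/
theorem integrable_DstSq (hφc : Continuous (φ N)) (hφ0 : ∀ y, 0 ≤ φ N y) (hφb : ∀ y, φ N y ≤ Φb)
    (hVb : 0 ≤ Vb) (hV : ∀ i, ‖(w i).2‖ ≤ Vb) :
    Integrable (fun x : T3 => ∑ j, ∑ k, Dst φ N w x j k ^ 2) := by
  -- (the composition is kept as `_ ∘ Prod.mk w`: unifying it against the stated lambda through the
  -- block fields with metavariables pending is pathologically slow for the elaborator)
  have hm := (measurable_DstSq hφc).comp (measurable_prodMk_left (α := Cfg N) (β := T3) (x := w))
  refine Integrable.mono' (integrable_const (9 * (8 * Φb * Vb ^ 2) ^ 2 + (4 * Φb * Vb ^ 3) ^ 2))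
    hm.aestronglyMeasurable (ae_of_all _ fun x => ?_)
  rw [Real.norm_eq_abs, abs_of_nonneg (by positivity)]
  exact DstSq_le hφ0 hφb hVb hV

/-- The `q`-channel density `x ↦ |q(w, x)|²` is integrable on `𝕋³` for a continuous kernel
`0 ≤ φ ≤ Φ_b` and a configuration with speeds `≤ V`. [folklore] -/
theorem integrable_qflSq (hφc : Continuous (φ N)) (hφ0 : ∀ y, 0 ≤ φ N y) (hφb : ∀ y, φ N y ≤ Φb)
    (hVb : 0 ≤ Vb) (hV : ∀ i, ‖(w i).2‖ ≤ Vb) :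
    Integrable (fun x : T3 => ‖qfl φ N w x‖ ^ 2) := by
  have hm := (measurable_qflSq hφc).comp (measurable_prodMk_left (α := Cfg N) (β := T3) (x := w))
  refine Integrable.mono' (integrable_const (9 * (8 * Φb * Vb ^ 2) ^ 2 + (4 * Φb * Vb ^ 3) ^ 2))
    hm.aestronglyMeasurable (ae_of_all _ fun x => ?_)
  rw [Real.norm_eq_abs, abs_of_nonneg (by positivity)]
  exact qflSq_le hφ0 hφb hVb hV

end Bounds

/-- A continuous kernel slice is bounded above on the compact torus. [folklore] -/
theorem exists_kernel_bound (hφc : Continuous (φ N)) : ∃ Φb : ℝ, ∀ y, φ N y ≤ Φb := by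
  obtain ⟨Φb, hΦb⟩ := isCompact_univ.exists_bound_of_continuousOn hφc.continuousOn
  refine ⟨Φb, fun y => ?_⟩
  have h := hΦb y (mem_univ y)
  rw [Real.norm_eq_abs] at h
  exact (le_abs_self _).trans h

/-! ### Along a good orbit -/

/-- **Orbit regularity of the block kinetic fluxes on a GOOD initial datum.** For a continuous
nonnegative kernel slice and `z ∈ (Φ N).good`: the two channel densities of `Φ_N(s) z` are integrable
on `𝕋³` for every `s ∈ [0, t]`, and their space integrals are integrable in `s` on `[0, t]` (speeds
along the orbit are `≤ √(2 E(z))` by energy conservation, the orbit is measurable in time, Fubini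
measurability of the space integrals, `[0, t]` has finite measure). [folklore] -/
theorem orbit_regular {σ : ℝ} (Φ : Flows σ) (hφc : Continuous (φ N)) (hφ0 : ∀ y, 0 ≤ φ N y)
    {z : Cfg N} (hz : z ∈ (Φ N).good) (t : ℝ) :
    (∀ s ∈ Icc 0 t, Integrable (fun x : T3 => ∑ j, ∑ k, Dst φ N ((Φ N).flow s z) x j k ^ 2)) ∧
    (∀ s ∈ Icc 0 t, Integrable (fun x : T3 => ‖qfl φ N ((Φ N).flow s z) x‖ ^ 2)) ∧
    IntegrableOn (fun s : ℝ => ∫ x, ∑ j, ∑ k, Dst φ N ((Φ N).flow s z) x j k ^ 2) (Icc 0 t) ∧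
    IntegrableOn (fun s : ℝ => ∫ x, ‖qfl φ N ((Φ N).flow s z) x‖ ^ 2) (Icc 0 t) := by
  -- the kernel slice is bounded, speeds along the orbit are bounded by energy conservation
  obtain ⟨Φb, hφb⟩ := exists_kernel_bound hφc
  set Vb : ℝ := Real.sqrt (2 * configEnergy z) with hVb_def
  have hVb : 0 ≤ Vb := Real.sqrt_nonneg _
  have hV : ∀ (s : ℝ) (i : Fin (N + 1)), ‖((Φ N).flow s z i).2‖ ≤ Vb := fun s i =>
    norm_vel_orbit_le Φ hz s i
  set M : ℝ := 9 * (8 * Φb * Vb ^ 2) ^ 2 + (4 * Φb * Vb ^ 3) ^ 2 with hM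
  -- joint measurability in `(s, x)` through the orbit
  have hg : Measurable fun q : ℝ × T3 => (((Φ N).flow q.1 z, q.2) : Cfg N × T3) :=
    ((measurable_orbit Φ hz).comp measurable_fst).prodMk measurable_snd
  have hDm : Measurable ((fun p : Cfg N × T3 => ∑ j, ∑ k, Dst φ N p.1 p.2 j k ^ 2) ∘
      fun q : ℝ × T3 => (((Φ N).flow q.1 z, q.2) : Cfg N × T3)) :=
    (measurable_DstSq hφc).comp hg
  have hqm : Measurable ((fun p : Cfg N × T3 => ‖qfl φ N p.1 p.2‖ ^ 2) ∘
      fun q : ℝ × T3 => (((Φ N).flow q.1 z, q.2) : Cfg N × T3)) :=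
    (measurable_qflSq hφc).comp hg
  -- the space integrals: measurable in `s` and bounded by `M` (the torus has volume one)
  have hGDm : Measurable fun s : ℝ => ∫ x, ∑ j, ∑ k, Dst φ N ((Φ N).flow s z) x j k ^ 2 :=
    hDm.stronglyMeasurable.integral_prod_right'.measurable
  have hGqm : Measurable fun s : ℝ => ∫ x, ‖qfl φ N ((Φ N).flow s z) x‖ ^ 2 :=
    hqm.stronglyMeasurable.integral_prod_right'.measurable
  have hGDb : ∀ s, ‖∫ x, ∑ j, ∑ k, Dst φ N ((Φ N).flow s z) x j k ^ 2‖ ≤ M := fun s => by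
    refine (norm_integral_le_of_norm_le (integrable_const M) (ae_of_all _ fun x => ?_)).trans ?_
    · rw [Real.norm_eq_abs, abs_of_nonneg (by positivity)]
      exact DstSq_le hφ0 hφb hVb (hV s)
    · simp
  have hGqb : ∀ s, ‖∫ x, ‖qfl φ N ((Φ N).flow s z) x‖ ^ 2‖ ≤ M := fun s => by
    refine (norm_integral_le_of_norm_le (integrable_const M) (ae_of_all _ fun x => ?_)).trans ?_
    · rw [Real.norm_eq_abs, abs_of_nonneg (by positivity)]
      exact qflSq_le hφ0 hφb hVb (hV s)
    · simp
  refine ⟨fun s _ => integrable_DstSq hφc hφ0 hφb hVb (hV s),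
    fun s _ => integrable_qflSq hφc hφ0 hφb hVb (hV s), ?_, ?_⟩
  · exact Measure.integrableOn_of_bounded measure_Icc_lt_top.ne hGDm.aestronglyMeasurable
      (ae_of_all _ hGDb)
  · exact Measure.integrableOn_of_bounded measure_Icc_lt_top.ne hGqm.aestronglyMeasurable
      (ae_of_all _ hGqb)

end BlockFluxRegularity

open BlockFluxRegularity in
/-- **Registered stub `stub_blockFluxRegularity` (line `birth`, crux `FastMomentRelaxation`,
stmt-AtomisticToContinuum-9522): ORBIT REGULARITY OF THE BLOCK KINETIC FLUXES.** For any `σ`, any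
flow family `Φ`, any kernel family `φ` whose slice `φ N` is continuous and nonnegative, any profiles
and any horizon `t`: for `localGibbsLaw`-a.e. initial datum `z` the maps
`x ↦ Σ_jk Dst φ N (Φ_N(s) z) x j k ²` and `x ↦ ‖qfl φ N (Φ_N(s) z) x‖²` are integrable on `𝕋³` for
every `s ∈ [0, t]`, and their space integrals are integrable in `s` on `[0, t]`. The bad set of the
flow is null for the local Gibbs law (`localGibbsLaw_compl_good'`); on a good orbit apply
`BlockFluxRegularity.orbit_regular`. [folklore] -/
theorem stub_blockFluxRegularity :
    ∀ (σ : ℝ) (Φ : Flows σ) (φ : ℕ → T3 → ℝ) (N : ℕ), Continuous (φ N) → (∀ y, 0 ≤ φ N y) → ∀ (a₀ θ₀ : T3 → ℝ) (u₀ : T3 → V3) (t : ℝ), ∀ᵐ z ∂(localGibbsLaw σ a₀ u₀ θ₀ N (Φ N)), (∀ s ∈ Icc 0 t, Integrable (fun x : T3 => ∑ j, ∑ k, Dst φ N ((Φ N).flow s z) x j k ^ 2)) ∧ (∀ s ∈ Icc 0 t, Integrable (fun x : T3 => ‖qfl φ N ((Φ N).flow s z) x‖ ^ 2)) ∧ IntegrableOn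 (fun s : ℝ => ∫ x, ∑ j, ∑ k, Dst φ N ((Φ N).flow s z) x j k ^ 2) (Icc 0 t) ∧ IntegrableOn (fun s : ℝ => ∫ x, ‖qfl φ N ((Φ N).flow s z) x‖ ^ 2) (Icc 0 t) := by
  intro σ Φ φ N hφc hφ0 a₀ θ₀ u₀ t
  -- the bad set of the flow is null for the local Gibbs law
  have h0 : localGibbsLaw σ a₀ u₀ θ₀ N (Φ N) (Φ N).goodᶜ = 0 := localGibbsLaw_compl_good' (Φ N)
  have hae : ∀ᵐ z ∂(localGibbsLaw σ a₀ u₀ θ₀ N (Φ N)), z ∈ (Φ N).good := by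
    have h := compl_mem_ae_iff.2 h0
    rwa [compl_compl] at h
  filter_upwards [hae] with z hz
  exact orbit_regular Φ hφc hφ0 hz t

end Summit.AtomisticToContinuum.HydrodynamicLimit.Theorems.FastMomentRelaxationBirth

end
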